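/-
Copyright (c) 2026 the pub-hodgecm-mathlib formalisation cell (harness21).  Prover seat hodgecm-mathlib-K2E2-p12 (g4): Track B «K2-LIT», ENGINE E1,
h413 = stmt-HodgeConjecture-24833; K2E1-plan (g4) «GO (q9) FILE 2 (b)» 2026-09-04T06:53:00Z, parts (b1) + (b3): regrouping by places of the base, and the
finite components of the trace-zero line `θ t = (t ⊗ 1)·δ`.
-/
import Summits.HodgeConjecture.HodgeConjecture.Theorems.K2E1IntertwiningLocalFactorU2Height   -- ★ p858153 (this seat), part (b2): `‖ι_w x‖_w = ‖x‖_v^{ef}`, `∏_{w∣v} max(1,‖ι_w x‖_w) = max(1,‖x‖_v)^{[L:K]}`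
import Literature.NumberTheory.Automorphic.UnitaryGroupTraceZeroLine                          -- ★ `traceZeroLine F E c hcδ hδ : 𝔸_F ≃ₜ+ 𝔸_E⁻`, `coe_traceZeroLine` (`θ t = (t ⊗ 1)·δ`)
import Literature.NumberTheory.Automorphic.LocalFieldHaarBalls                                -- ★ `LocalFieldHaar.continuous_normAbs`
import HarnessLib

/-!
# K2·E1 — `K2E1IntertwiningLocalFactorU2Line` (FILE 2 (b), parts (b1) + (b3)): REGROUPING `∏ᶠ_{w of L} = ∏ᶠ_{v of K} ∏_{w ∣ v}` AND THE FINITE COMPONENTS OF THE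
# TRACE-ZERO LINE `θ t = (t ⊗ 1)·δ` — the finite height factor `h_f(b) = ∏ᶠ_w max(1, ‖θ(0,b)_w‖)` of ★ `K2E1HeightBigCellLineFormulaU2` read place-by-place over the base

Track B ∕ K2-LIT, crux h413 = `stmt-HodgeConjecture-24833`, route of record `HCCMUnconditional`; cell `hodgecm-mathlib`, squad K2, ENGINE E1 (campaign «EIS-RANK-ONE», R7₂ FILE 2 (b)).
Dealer K2E1-plan (g4) «GO (q9) FILE 2 (b)» (06:53:00Z).  THEOREMS ONLY (no `def`, no instance, no notation, no named-fact hypothesis, no `sorry`; default heartbeats); lane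
`--supports stmt-HodgeConjecture-24833 --as helper` (count-neutral).

THE MATHEMATICS [CasselsFrohlichANT1967, Ch. II §11–§14; NeukirchANT1999, Ch. II (6.8), Ch. VI §1].
* §1 (b1) REGROUPING (generic extension of number fields `L/K`): for `g : {places of L} → M` with finite support, **`∏ᶠ_w g w = ∏ᶠ_v ∏_{w ∣ v} g w`**, the inner product over the
  FLT-packet type `v.Extension (𝓞 L) = {w // w.under (𝓞 K) = v}` (★ `Extension.fintype`).
* §2 (b3) COMPONENTS OF THE LINE (generic quadratic `E/F`, `c δ = −δ ≠ 0`): **`(θ t)_w = ι_w(t_{w|F}) · δ_w`** for every finite place `w` of `E` (`rfl` through ★ `coe_traceZeroLine`,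
  ★ `baseChange_snd_apply`, ★ `mapSemialgHom_apply`), hence `‖(θ t)_w‖ = ‖ι_w(t_{w|F})‖_w · ‖δ‖_w` (Mathlib's norm = ★ `normAbs`); and **`‖δ‖_w = 1` for all but finitely many `w`**
  (`δ, δ⁻¹` are integral at almost every place), so the set `S_δ` of places `v` of `F` under a `w` with `‖δ‖_w ≠ 1` is finite.
* §3 THE LOCAL FACTOR AT `v`: `P_v(x) := ∏_{w∣v} max(1, ‖ι_w x‖_w·‖δ‖_w)` is continuous; for `v ∉ S_δ` it is `∏_{w∣v} max(1, ‖ι_w x‖_w) = max(1, ‖x‖_v)^{[E:F]} = max(1, ‖x‖_v)²`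
  (★ (b2) `prod_extension_max_one_normAbs`), `= 1` on `𝒪_v`; and **`h_f(b) = ∏ᶠ_w max(1, ‖θ(0,b)_w‖) = ∏ᶠ_v P_v(b_v)`** (§1), with `h_f(b)^{−σ} = ∏ᶠ_v P_v(b_v)^{−σ}` — the
  factorizable integrand that ★ `AdelicProductIntegral.hasProd_localIntegral_of_integrable` consumes in FILE 3 (`K2E1IntertwiningScalarEulerProductU2`).
HONEST LABEL: HC_CM is proved only modulo the 7 printed citations (2 remaining named inputs: hLiu418 = `stmt-HodgeConjecture-24832`, h413 = `stmt-HodgeConjecture-24833`) until rung 0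
closes; this file asserts no named fact and closes no socket; count-neutral.

## References
* [CasselsFrohlichANT1967] J. W. S. Cassels, *Global fields*, in Cassels–Fröhlich (1967), Ch. II §11 (normalised valuations under extension), §14 (adeles under base change).
* [NeukirchANT1999] J. Neukirch, *Algebraic Number Theory* (1999), Ch. II (6.8), Ch. VI §1 (ideles, `‖a‖_w = 1` for almost all `w`).
* [FLTProject2025] K. Buzzard et al., FLT project, `FLT/DedekindDomain/FiniteAdeleRing/BaseChange.lean`.
-/

set_option autoImplicit false
set_option linter.dupNamespace false -- the mandated namespace repeats `HodgeConjecture.HodgeConjecture`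

noncomputable section

open NumberField IsDedekindDomain IsDedekindDomain.HeightOneSpectrum Function Set
open scoped NNReal
open Literature.NumberTheory.GaloisRepresentations.IsNonarchimedeanLocalField
open Literature.NumberTheory.Automorphic Literature.NumberTheory.Automorphic.UnitaryGroup
open Summit.HodgeConjecture.HodgeConjecture.Cruxes.H413.K2E1IntertwiningLocalFactorU2Height

namespace Summit.HodgeConjecture.HodgeConjecture.Cruxes.H413.K2E1IntertwiningLocalFactorU2Line

/-! ## §1 (b1) Regrouping a finitely supported product over the places of `L` by the places of `K` -/

section Regroup

variable (K L : Type) [Field K] [NumberField K] [Field L] [NumberField L] [Algebra K L]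
  {M : Type*} [CommMonoid M]

/-- **`∏ᶠ_{w} g w = ∏ᶠ_{v} ∏_{w ∣ v} g w`** for a finitely supported `g` on the finite places of `L`, the inner product over the FLT-packet fibre type `v.Extension (𝓞 L)`
(`w.under (𝓞 K) = v`; finite, ★ `Extension.fintype`). [cite: CasselsFrohlichANT1967, Ch. II §11] -/
theorem finprod_eq_finprod_prod_extension (g : HeightOneSpectrum (𝓞 L) → M) (hg : (mulSupport g).Finite) :
    ∏ᶠ w, g w = ∏ᶠ v : HeightOneSpectrum (𝓞 K), (letI := Extension.fintype (𝓞 K) K L (𝓞 L) v; ∏ w : v.Extension (𝓞 L), g w.1) := by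
  classical
  set s : Finset (HeightOneSpectrum (𝓞 L)) := hg.toFinset with hs
  set T : Finset (HeightOneSpectrum (𝓞 K)) := s.image (fun w => w.under (𝓞 K)) with hT
  -- the inner product at `v` is the product over the part of `s` above `v`
  have hinner : ∀ v : HeightOneSpectrum (𝓞 K),
      (letI := Extension.fintype (𝓞 K) K L (𝓞 L) v; ∏ w : v.Extension (𝓞 L), g w.1) = ∏ w ∈ s with w.under (𝓞 K) = v, g w := by
    intro v
    letI := Extension.fintype (𝓞 K) K L (𝓞 L) v
    have hfib : ({w : HeightOneSpectrum (𝓞 L) | w.under (𝓞 K) = v} : Set _).Finite := Set.finite_coe_iff.1 (Extension.finite (𝓞 K) K L (𝓞 L) v)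
    have h1 : (∏ w : v.Extension (𝓞 L), g w.1) = ∏ w ∈ hfib.toFinset, g w :=
      (Finset.prod_subtype (F := Extension.fintype (𝓞 K) K L (𝓞 L) v) hfib.toFinset (fun w => by rw [Set.Finite.mem_toFinset]; rfl) g).symm
    rw [h1]
    refine (Finset.prod_subset (fun w hw => ?_) (fun w hw hw' => ?_)).symm
    · rw [Finset.mem_filter] at hw
      exact hfib.mem_toFinset.2 hw.2
    · rw [Set.Finite.mem_toFinset] at hw
      by_contra hne
      exact hw' (Finset.mem_filter.2 ⟨hg.mem_toFinset.2 hne, hw⟩)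
  simp_rw [hinner]
  have hsuppT : (mulSupport fun v : HeightOneSpectrum (𝓞 K) => ∏ w ∈ s with w.under (𝓞 K) = v, g w) ⊆ (T : Set (HeightOneSpectrum (𝓞 K))) := by
    intro v hv
    rw [mem_mulSupport] at hv
    obtain ⟨w, hw, hne⟩ := Finset.exists_ne_one_of_prod_ne_one hv
    rw [Finset.mem_filter] at hw
    exact Finset.mem_coe.2 (Finset.mem_image.2 ⟨w, hw.1, hw.2⟩)
  rw [finprod_eq_prod_of_mulSupport_subset _ (show mulSupport g ⊆ (s : Set _) by rw [hs, Set.Finite.coe_toFinset]),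
    finprod_eq_prod_of_mulSupport_subset _ hsuppT]
  exact (Finset.prod_fiberwise_of_maps_to (fun w hw => Finset.mem_image_of_mem _ hw) g).symm

end Regroup

/-! ## §2 (b3) The finite components of the trace-zero line `θ t = (t ⊗ 1)·δ`, and `‖δ‖_w = 1` for almost all `w` -/

section Line

variable {F E : Type} [Field F] [NumberField F] [Field E] [NumberField E] [Algebra F E] (c : E ≃ₐ[F] E) {δ : E}
  [Algebra.IsQuadraticExtension F E] (hcδ : c δ = -δ) (hδ : δ ≠ 0)

/-- Mathlib's norm on `E_w` is the normalised absolute value ★ `normAbs` (`q_w^{−ord}` on both sides; reproduced from ★ `GlobalHeckeTheoryGL2OfCenterInvariant.norm_eq_coe_normAbs` to keep the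
import closure small). [folklore] -/
private theorem nnnorm_eq_normAbs' (w : HeightOneSpectrum (𝓞 E)) (x : w.adicCompletion E) : ‖x‖₊ = normAbs (w.adicCompletion E) x := by
  apply NNReal.eq
  rw [coe_nnnorm]
  by_cases hx : x = 0
  · rw [hx, norm_zero, map_zero, NNReal.coe_zero]
  have hv : Valued.v x ≠ 0 := (Valuation.ne_zero_iff _).2 hx
  have hxn : Valued.v x = WithZero.exp (Multiplicative.toAdd (WithZero.unzero hv)) := by
    rw [WithZero.exp, ofAdd_toAdd, WithZero.coe_unzero]
  rw [FinitePlace.norm_def, WithZeroMulInt.toNNReal_neg_apply _ hv,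
    normAbs_eq_inv_zpow_of_valued_eq w hxn, residueFieldCard_adicCompletion_eq, inv_zpow', neg_neg]
  rfl

/-- `x ∈ 𝒪_v ⇒ ‖x‖_v ≤ 1` (★ `mem_primePowBall_zero_iff` + ★ `mem_primePowBall_iff` at exponent `0`). [folklore] -/
private theorem normAbs_le_one_of_mem_integers {K : Type} [Field K] [NumberField K] (v : HeightOneSpectrum (𝓞 K)) {x : v.adicCompletion K}
    (hx : x ∈ v.adicCompletionIntegers K) : normAbs (v.adicCompletion K) x ≤ 1 := by
  have h := (mem_primePowBall_zero_iff x).2 hx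
  rwa [mem_primePowBall_iff, zpow_zero] at h

/-- **`(θ t)_w = ι_w(t_{w|F}) · δ_w`**: the `w`-component of the trace-zero line is the local base change `ι_w : F_v → E_w` (`v = w|F`, ★ FLT packet) of `t_v`, times `δ`.
Definitional through ★ `coe_traceZeroLine`, ★ `baseChange_snd_apply`, ★ `mapSemialgHom_apply`. [cite: CasselsFrohlichANT1967, Ch. II §14] -/
theorem traceZeroLine_snd_apply (t : AdeleRing (𝓞 F) F) (w : HeightOneSpectrum (𝓞 E)) :
    ((traceZeroLine F E c hcδ hδ t : traceZeroAdele F E c) : AdeleRing (𝓞 E) E).2 w =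
      Extension.adicCompletionSemialgHom F E (v := w.under (𝓞 F)) ⟨w, rfl⟩ (t.2 (w.under (𝓞 F))) * (algebraMap E (FiniteAdeleRing (𝓞 E) E) δ) w := rfl

/-- The finite part of `θ(a, b)` does not see the archimedean coordinate `a`. [cite: CasselsFrohlichANT1967, Ch. II §14] -/
theorem traceZeroLine_snd_apply_mk (a : InfiniteAdeleRing F) (b : FiniteAdeleRing (𝓞 F) F) (w : HeightOneSpectrum (𝓞 E)) :
    ((traceZeroLine F E c hcδ hδ ((a, b) : AdeleRing (𝓞 F) F) : traceZeroAdele F E c) : AdeleRing (𝓞 E) E).2 w =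
      Extension.adicCompletionSemialgHom F E (v := w.under (𝓞 F)) ⟨w, rfl⟩ (b (w.under (𝓞 F))) * (algebraMap E (FiniteAdeleRing (𝓞 E) E) δ) w := rfl

/-- **`‖(θ(a,b))_w‖ = ‖ι_w(b_{w|F})‖_w · ‖δ‖_w`** in the normalised absolute values. [cite: CasselsFrohlichANT1967, Ch. II §11, §14] -/
theorem nnnorm_traceZeroLine_snd_apply_mk (a : InfiniteAdeleRing F) (b : FiniteAdeleRing (𝓞 F) F) (w : HeightOneSpectrum (𝓞 E)) :
    ‖((traceZeroLine F E c hcδ hδ ((a, b) : AdeleRing (𝓞 F) F) : traceZeroAdele F E c) : AdeleRing (𝓞 E) E).2 w‖₊ =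
      normAbs (w.adicCompletion E) (Extension.adicCompletionSemialgHom F E (v := w.under (𝓞 F)) ⟨w, rfl⟩ (b (w.under (𝓞 F)))) *
        normAbs (w.adicCompletion E) ((algebraMap E (FiniteAdeleRing (𝓞 E) E) δ) w) := by
  rw [traceZeroLine_snd_apply_mk, nnnorm_mul, nnnorm_eq_normAbs', nnnorm_eq_normAbs']

omit [NumberField F] [Algebra.IsQuadraticExtension F E] in
/-- **`v_w(δ) = 1` for all but finitely many `w`** (`δ ≠ 0`: both `δ` and `δ⁻¹` are `w`-integral at almost every `w` — the restricted-product condition of a principal finite adele).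
[cite: NeukirchANT1999, Ch. VI §1] -/
theorem finite_setOf_valued_algebraMap_ne_one (hδ : δ ≠ 0) :
    {w : HeightOneSpectrum (𝓞 E) | Valued.v ((algebraMap E (FiniteAdeleRing (𝓞 E) E) δ) w) ≠ 1}.Finite := by
  have h1 := (algebraMap E (FiniteAdeleRing (𝓞 E) E) δ).eventually
  have h2 := (algebraMap E (FiniteAdeleRing (𝓞 E) E) δ⁻¹).eventually
  refine (Filter.eventually_cofinite.1 (h1.and h2)).subset fun w hw => ?_
  rw [mem_setOf_eq] at hw ⊢
  rintro ⟨hδw, hδw'⟩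
  rw [SetLike.mem_coe, mem_adicCompletionIntegers] at hδw hδw'
  have hmul : Valued.v ((algebraMap E (FiniteAdeleRing (𝓞 E) E) δ) w) * Valued.v ((algebraMap E (FiniteAdeleRing (𝓞 E) E) δ⁻¹) w) = 1 := by
    rw [← map_mul]
    change Valued.v ((algebraMap E (FiniteAdeleRing (𝓞 E) E) δ * algebraMap E (FiniteAdeleRing (𝓞 E) E) δ⁻¹) w) = 1
    rw [← map_mul, mul_inv_cancel₀ hδ, map_one]
    exact map_one _
  refine hw (le_antisymm hδw ?_)
  calc (1 : _) = Valued.v ((algebraMap E (FiniteAdeleRing (𝓞 E) E) δ) w) * Valued.v ((algebraMap E (FiniteAdeleRing (𝓞 E) E) δ⁻¹) w) := hmul.symm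
    _ ≤ Valued.v ((algebraMap E (FiniteAdeleRing (𝓞 E) E) δ) w) * 1 := by gcongr; exact hδw'
    _ = Valued.v ((algebraMap E (FiniteAdeleRing (𝓞 E) E) δ) w) := mul_one _

omit [NumberField F] [Algebra.IsQuadraticExtension F E] in
/-- **`‖δ‖_w = 1` for all but finitely many `w`** (`δ ≠ 0`). [cite: NeukirchANT1999, Ch. VI §1] -/
theorem finite_setOf_normAbs_algebraMap_ne_one (hδ : δ ≠ 0) :
    {w : HeightOneSpectrum (𝓞 E) | normAbs (w.adicCompletion E) ((algebraMap E (FiniteAdeleRing (𝓞 E) E) δ) w) ≠ 1}.Finite := by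
  refine (finite_setOf_valued_algebraMap_ne_one (E := E) hδ).subset fun w hw => ?_
  rw [mem_setOf_eq] at hw ⊢
  intro h1
  apply hw
  have h := normAbs_eq_inv_zpow_of_valued_eq w (x := (algebraMap E (FiniteAdeleRing (𝓞 E) E) δ) w) (n := 0) (by rw [h1, WithZero.exp_zero])
  rw [h, neg_zero, zpow_zero]

omit [Algebra.IsQuadraticExtension F E] in
/-- **The exceptional set `S_δ` of places of `F` is finite**: only finitely many `v` lie under a `w` with `‖δ‖_w ≠ 1`. [cite: NeukirchANT1999, Ch. VI §1] -/
theorem finite_setOf_exists_extension_normAbs_ne_one (hδ : δ ≠ 0) :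
    {v : HeightOneSpectrum (𝓞 F) | ∃ w : v.Extension (𝓞 E), normAbs (w.1.adicCompletion E) ((algebraMap E (FiniteAdeleRing (𝓞 E) E) δ) w.1) ≠ 1}.Finite := by
  refine ((finite_setOf_normAbs_algebraMap_ne_one (E := E) hδ).image fun w => w.under (𝓞 F)).subset fun v hv => ?_
  obtain ⟨w, hw⟩ := hv
  exact ⟨w.1, hw, w.2⟩

/-! ## §3 The local factor `P_v(x) = ∏_{w∣v} max(1, ‖ι_w x‖_w·‖δ‖_w)` and `h_f(b) = ∏ᶠ_v P_v(b_v)` -/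

omit [Algebra.IsQuadraticExtension F E] in
/-- **`P_v` is continuous** (`ι_w` continuous ★, `normAbs` continuous ★, finite product). [cite: CasselsFrohlichANT1967, Ch. II §11] -/
theorem continuous_prod_extension_max_one (v : HeightOneSpectrum (𝓞 F)) :
    Continuous fun x : v.adicCompletion F => (letI := Extension.fintype (𝓞 F) F E (𝓞 E) v;
      ∏ w : v.Extension (𝓞 E), max 1 (normAbs (w.1.adicCompletion E) (Extension.adicCompletionSemialgHom F E w x) * normAbs (w.1.adicCompletion E) ((algebraMap E (FiniteAdeleRing (𝓞 E) E) δ) w.1))) := by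
  letI := Extension.fintype (𝓞 F) F E (𝓞 E) v
  exact continuous_finsetProd _ fun w _ =>
    continuous_const.max ((LocalFieldHaar.continuous_normAbs.comp (Extension.adicCompletionSemialgHom_continuous F E w)).mul continuous_const)

omit [Algebra.IsQuadraticExtension F E] in
/-- **Off `S_δ` the twist by `δ` is invisible**: if `‖δ‖_w = 1` for every `w ∣ v` then `P_v(x) = ∏_{w∣v} max(1, ‖ι_w x‖_w) = max(1, ‖x‖_v)^{[E:F]}` (★ (b2) `prod_extension_max_one_normAbs`).
[cite: CasselsFrohlichANT1967, Ch. II §11] -/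
theorem prod_extension_max_one_eq_pow (v : HeightOneSpectrum (𝓞 F))
    (hv : ∀ w : v.Extension (𝓞 E), normAbs (w.1.adicCompletion E) ((algebraMap E (FiniteAdeleRing (𝓞 E) E) δ) w.1) = 1) (x : v.adicCompletion F) :
    (letI := Extension.fintype (𝓞 F) F E (𝓞 E) v;
      ∏ w : v.Extension (𝓞 E), max 1 (normAbs (w.1.adicCompletion E) (Extension.adicCompletionSemialgHom F E w x) * normAbs (w.1.adicCompletion E) ((algebraMap E (FiniteAdeleRing (𝓞 E) E) δ) w.1))) =
      (max 1 (normAbs (v.adicCompletion F) x)) ^ Module.finrank F E := by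
  letI := Extension.fintype (𝓞 F) F E (𝓞 E) v
  have h := prod_extension_max_one_normAbs F E v x
  rw [← h]
  exact Finset.prod_congr rfl fun w _ => by rw [hv w, mul_one]

/-- **For a quadratic `E/F`, off `S_δ`: `P_v(x) = max(1, ‖x‖_v)²`.** [cite: CasselsFrohlichANT1967, Ch. II §11] -/
theorem prod_extension_max_one_eq_sq (v : HeightOneSpectrum (𝓞 F))
    (hv : ∀ w : v.Extension (𝓞 E), normAbs (w.1.adicCompletion E) ((algebraMap E (FiniteAdeleRing (𝓞 E) E) δ) w.1) = 1) (x : v.adicCompletion F) :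
    (letI := Extension.fintype (𝓞 F) F E (𝓞 E) v;
      ∏ w : v.Extension (𝓞 E), max 1 (normAbs (w.1.adicCompletion E) (Extension.adicCompletionSemialgHom F E w x) * normAbs (w.1.adicCompletion E) ((algebraMap E (FiniteAdeleRing (𝓞 E) E) δ) w.1))) =
      (max 1 (normAbs (v.adicCompletion F) x)) ^ 2 := by
  rw [prod_extension_max_one_eq_pow (E := E) v hv x, Algebra.IsQuadraticExtension.finrank_eq_two F E]

omit [Algebra.IsQuadraticExtension F E] in
/-- **Off `S_δ` the local factor is `1` on `𝒪_v`** (`‖x‖_v ≤ 1`): the hypothesis `f_v = 1 on the integral box` of ★ `AdelicProductIntegral`. [cite: CasselsFrohlichANT1967, Ch. II §11] -/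
theorem prod_extension_max_one_eq_one_of_mem_integers (v : HeightOneSpectrum (𝓞 F))
    (hv : ∀ w : v.Extension (𝓞 E), normAbs (w.1.adicCompletion E) ((algebraMap E (FiniteAdeleRing (𝓞 E) E) δ) w.1) = 1)
    {x : v.adicCompletion F} (hx : x ∈ v.adicCompletionIntegers F) :
    (letI := Extension.fintype (𝓞 F) F E (𝓞 E) v;
      ∏ w : v.Extension (𝓞 E), max 1 (normAbs (w.1.adicCompletion E) (Extension.adicCompletionSemialgHom F E w x) * normAbs (w.1.adicCompletion E) ((algebraMap E (FiniteAdeleRing (𝓞 E) E) δ) w.1))) = 1 := by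
  rw [prod_extension_max_one_eq_pow (E := E) v hv x]
  rw [max_eq_left (normAbs_le_one_of_mem_integers v hx), one_pow]

/-- **`h_f(b) = ∏ᶠ_v P_v(b_v)`**: the finite height factor of the big-cell line formula (★ `K2E1HeightBigCellLineFormulaU2.coe_borelHeight_weylLongU_line_mul_eq_cm_two`, a finitely
supported product over the places `w` of `E`) regrouped over the places `v` of `F` (§1 + §2). [cite: CasselsFrohlichANT1967, Ch. II §11, §14] -/
theorem finprod_max_one_nnnorm_traceZeroLine_snd_eq (a : InfiniteAdeleRing F) (b : FiniteAdeleRing (𝓞 F) F) :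
    ∏ᶠ w : HeightOneSpectrum (𝓞 E), max 1 ‖((traceZeroLine F E c hcδ hδ ((a, b) : AdeleRing (𝓞 F) F) : traceZeroAdele F E c) : AdeleRing (𝓞 E) E).2 w‖₊ =
      ∏ᶠ v : HeightOneSpectrum (𝓞 F), (letI := Extension.fintype (𝓞 F) F E (𝓞 E) v;
        ∏ w : v.Extension (𝓞 E), max 1 (normAbs (w.1.adicCompletion E) (Extension.adicCompletionSemialgHom F E w (b v)) * normAbs (w.1.adicCompletion E) ((algebraMap E (FiniteAdeleRing (𝓞 E) E) δ) w.1))) := by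
  have hfin : (mulSupport fun w : HeightOneSpectrum (𝓞 E) =>
      max 1 ‖((traceZeroLine F E c hcδ hδ ((a, b) : AdeleRing (𝓞 F) F) : traceZeroAdele F E c) : AdeleRing (𝓞 E) E).2 w‖₊).Finite := by
    have h := (((traceZeroLine F E c hcδ hδ ((a, b) : AdeleRing (𝓞 F) F) : traceZeroAdele F E c) : AdeleRing (𝓞 E) E).2).eventually
    refine (Filter.eventually_cofinite.1 h).subset fun w hw => ?_
    rw [mem_setOf_eq]
    intro hint
    rw [mem_mulSupport] at hw
    apply hw
    rw [SetLike.mem_coe] at hint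
    have h1 : ‖((traceZeroLine F E c hcδ hδ ((a, b) : AdeleRing (𝓞 F) F) : traceZeroAdele F E c) : AdeleRing (𝓞 E) E).2 w‖₊ ≤ 1 := by
      rw [nnnorm_eq_normAbs']
      exact normAbs_le_one_of_mem_integers w hint
    exact max_eq_left h1
  rw [finprod_eq_finprod_prod_extension F E _ hfin]
  refine finprod_congr fun v => ?_
  letI := Extension.fintype (𝓞 F) F E (𝓞 E) v
  refine Finset.prod_congr rfl fun w _ => ?_
  obtain ⟨w, rfl⟩ := w
  rw [nnnorm_traceZeroLine_snd_apply_mk]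

/-- **`h_f(b)^{−σ} = ∏ᶠ_v P_v(b_v)^{−σ}`** (real exponent; the finite product commutes with `(·)^{−σ}` on `ℝ≥0`, and `P_v(b_v) = 1` for almost all `v`). This is the FACTORIZABLE integrand of
FILE 3. [cite: CasselsFrohlichANT1967, Ch. II §11, §14] -/
theorem coe_finprod_max_one_nnnorm_traceZeroLine_snd_rpow (a : InfiniteAdeleRing F) (b : FiniteAdeleRing (𝓞 F) F) (σ : ℝ) :
    ((∏ᶠ w : HeightOneSpectrum (𝓞 E), max 1 ‖((traceZeroLine F E c hcδ hδ ((a, b) : AdeleRing (𝓞 F) F) : traceZeroAdele F E c) : AdeleRing (𝓞 E) E).2 w‖₊ : ℝ≥0) : ℝ) ^ (-σ) =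
      ∏ᶠ v : HeightOneSpectrum (𝓞 F), ((letI := Extension.fintype (𝓞 F) F E (𝓞 E) v;
        ∏ w : v.Extension (𝓞 E), max 1 (normAbs (w.1.adicCompletion E) (Extension.adicCompletionSemialgHom F E w (b v)) * normAbs (w.1.adicCompletion E) ((algebraMap E (FiniteAdeleRing (𝓞 E) E) δ) w.1)) : ℝ≥0) : ℝ) ^ (-σ) := by
  rw [finprod_max_one_nnnorm_traceZeroLine_snd_eq c hcδ hδ a b]
  -- `x ↦ (x : ℝ)^{−σ}` is a monoid hom on `ℝ≥0`
  set φ : ℝ≥0 →* ℝ := ⟨⟨fun x => (x : ℝ) ^ (-σ), by rw [NNReal.coe_one, Real.one_rpow]⟩, fun x y => by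
    simp only [NNReal.coe_mul]; exact Real.mul_rpow x.2 y.2⟩ with hφ
  have hsupp : (mulSupport fun v : HeightOneSpectrum (𝓞 F) => (letI := Extension.fintype (𝓞 F) F E (𝓞 E) v;
      ∏ w : v.Extension (𝓞 E), max 1 (normAbs (w.1.adicCompletion E) (Extension.adicCompletionSemialgHom F E w (b v)) * normAbs (w.1.adicCompletion E) ((algebraMap E (FiniteAdeleRing (𝓞 E) E) δ) w.1)))).Finite := by
    have hS := finite_setOf_exists_extension_normAbs_ne_one (F := F) (E := E) hδ
    have hb := b.eventually
    refine (hS.union (Filter.eventually_cofinite.1 hb)).subset fun v hv => ?_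
    rw [mem_mulSupport] at hv
    by_contra hnot
    rw [mem_union, not_or, mem_setOf_eq, mem_setOf_eq, not_exists, not_not] at hnot
    exact hv (prod_extension_max_one_eq_one_of_mem_integers (E := E) v (fun w => not_not.1 (hnot.1 w)) hnot.2)
  exact (φ.map_finprod hsupp)

end Line

end Summit.HodgeConjecture.HodgeConjecture.Cruxes.H413.K2E1IntertwiningLocalFactorU2Line

end
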